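import Mathlib.Algebra.Order.Chebyshev
import Literature.Barriers.CriticalPhenomena.LongRangeTrivialityOnZ3TreeWick
import Literature.Barriers.CriticalPhenomena.LongRangeTrivialityOnZ3ProofsAudit
import HarnessLib

/-!
# Audit (D-0021, generation 2) of `LongRangeTrivialityOnZ3Proofs.lean`: the dividing line of the barrier
# `LongRangeTrivialityOnZ3` is the BUBBLE CONDITION — "the bubble condition implies triviality", proved
# in the tree at `β_c` for every MMS-monotone ferromagnetic pair interaction on `ℤ³`

Barrier catalogue `Literature/Barriers/CriticalPhenomena/` (D-0021), sub-problem `Ising3DConformalLimit`.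
Second audit record (refuter, barrier-audit mode, generation 2, 2026-08-15) for the sibling
`LongRangeTrivialityOnZ3Proofs.lean` (discharge of `panis_variance_bound`) of the barrier
`LongRangeTrivialityOnZ3`, after `LongRangeTrivialityOnZ3ProofsAudit.lean` (generation 1: the discharge
CONFIRMED; two narrowings — the technique class is the extensional `InteractionUniformZ3`, and the lower half
of the variance footnote is literally false). Generation 1's evasion note reads: nearest-neighbour-specific
outputs of the reflection-positivity/random-current toolbox exist on `ℤ³` at the two-point level,
`B(β_c) = ∞` (Duminil-Copin–Panis 2025), false for every `α < 3/2` member. This audit asks what that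
evasion is worth, and answers with a THEOREM: on `ℤ³` the divergence of the critical bubble diagram is
exactly the price of admission — necessary for non-Gaussianity of any MMS-monotone ferromagnet (proved
here), and not sufficient (`ℤ⁴`; the marginal member `α = 3/2`).

## Verdict: NARROWED — the technique class of `LongRangeTrivialityOnZ3` is "bubble-blindness"; the sharpened
## barrier `BubbleTrivialityOnZ3` is PROVED; the discharge audited (`panis_variance_bound_holds`) is CONFIRMED
## again and is one of its inputs

### A. What the sources print (page level)

* Remark 1.6 (arXiv p. 7): "As noticed in [A, aizenman1986critical], the bubble condition `B(β_c) < ∞`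
  implies that some of the model's critical exponents take their mean-field value. It is also possible to
  show that the bubble condition (together with some monotonicity properties of the two-point function),
  implies triviality of the scaling limits. We provide a proof of this fact in Appendix."
  [cite: Panis2023Triviality, Remark 1.6, p. 7]
* Appendix, Theorem 12.2 (p. 51), "The bubble condition implies triviality": "Let `d ≥ 2`. For a reflection
  positive model in `ℤ^d` with an interaction `J` satisfying the above conditions [(A1)–(A5), `ξ_σ`
  definable] and such that `B(ρ,β_c(ρ)) = ∑_x⟨τ₀τ_x⟩²_{ρ,β_c(ρ)} < ∞`, one has `lim_{β↗β_c(ρ)} g_σ(ρ,β) = 0`";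
  proof: the tree diagram bound `0 ≤ g_σ ≤ 2χ²/ξ_σ^d`, the splitting `χ = χ_{εξ} + (χ_{Lξ} - χ_{εξ}) + (χ - χ_{Lξ})`,
  Cauchy–Schwarz on the first two pieces (`√B`, `√(B_{Lξ} - B_{εξ})`), the MMS/Sokal bound on the third;
  Remark 12.3: extends to (A1)–(A4) plus the MMS inequalities, e.g. finite-range interactions.
  [cite: Panis2023Triviality, Theorem 12.2 and Remark 12.3, p. 51]
* Corollary 1.11 (p. 8; `1 ≤ d ≤ 3`, `α = d/2`, i.e. `d_eff = 4`): "`lim_{β↗β_c} g_σ(β) = 0`. As a consequence,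
  for `β = β_c`, every sub-sequential scaling limit of the model is Gaussian"; its proof (§7.5, p. 41) ends
  "Hence, if `B(β_c) = ∞`, one obtains the result taking `L` to infinity. If `B(β_c) < ∞`, we may conclude
  using Theorem 12.2" — the divergence of the bubble at the marginal member is NOT established, and is not
  needed. [cite: Panis2023Triviality, Corollary 1.11 (p. 8) and §7.5 (p. 41)]
* Duminil-Copin–Panis: "The condition `B(β_c) < ∞` also implies triviality of the critical scaling limits of
  the model, see [Pan23+]. … Theorem 1.8 (Divergence of the bubble diagram). Let `d = 3, 4`. Then
  `B(β_c) = ∞`" (nearest-neighbour Ising and `φ⁴`), with "Remark 1.9 … `B_n(β) ≥ c√(log n)` if `d = 3`,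
  `c√(log log n)` if `d = 4`" for `β ≤ β_c`, `n ≤ L(β)`. [cite: DuminilCopinPanis2025LowerBounds, Theorem 1.8 and Remark 1.9, pp. 6–7]
* Aizenman–Duminil-Copin: "included in Theorem 1.2 is the statement that for `d = 4` any scaling limit of the
  critical Ising model is Gaussian"; under the existence of `η`: "If `η > 0` the bubble diagram is finite and
  hence the desired statement is already contained in the tree diagram bound (1.20). Focus then on the case
  `η = 0`, for which the bubble diagram diverges logarithmically." [cite: AizenmanDuminilCopinAnnals2021, Theorem 1.2 and §3 (proof of Theorem 1.3 under assumption (3.2))]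

### B. What is proved here (all theorems; ONE definition, the sharpened barrier `BubbleTrivialityOnZ3`, D-0026)

For `d = 3`, a ferromagnetic translation-invariant pair interaction `J ≥ 0`, `β ≥ 0`, MMS2 at `β`
(`⟨σ₀σ_y⟩ ≤ ⟨σ₀σ_x⟩` for `3‖x‖ ≤ ‖y‖`) and a finite bubble `B(β) = ∑ₓ⟨σ₀σ_x⟩²_β`:

* `boxRowSum_le_uniform_mms`: `F_{RL}(u) = ∑_{y∈Λ_{RL}}⟨σ_uσ_y⟩ ≤ 730·125R³χ_L` for ALL `u`;
* `tsum_sq_boxRowSum_le`: `∑_u F_N(u)² ≤ 2|Λ_ℓ||Λ_N|B + 2|Λ_N|²∑_{x∉Λ_ℓ}⟨σ₀σ_x⟩²` for every scale `ℓ`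
  (Cauchy–Schwarz after splitting the row sum at distance `ℓ` — the finite-bubble splitting of Theorem 12.2);
* `treeFourBoxSum_le_of_summable_sq`: with `∑_{u∈Λ_N⁴}T(u) = ∑_vF_N(v)⁴ ≤ M²∑_vF_N(v)²` and `Σ_L ≥ (L+1)³χ_L`
  the factors `χ_L²` cancel: `𝒮_T(β,L,R) ≤ (730·125R³)²(2|Λ_ℓ|(2R+1)³B/(L+1)³ + 2(2R+1)⁶(B - B_ℓ))`;
* `tendsto_treeFourBoxSum_of_summable_sq` (`𝒮_T → 0`), `tendsto_mgfDeviation_of_summable_sq`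
  (`|⟨e^{zT_{f,L,β}}⟩ - e^{(z²/2)⟨T²_{f,L,β}⟩}| → 0`, through the PROVED tree-graph Wick bound
  `mgfDeviation_le_tree` and the audited variance bound `state_smeared_sq_le`);
* `not_hasNonGaussianSmearingZ3_of_summable_sq` (general `J`, at `β_c`; `β_c = 0` by independence),
  `not_hasNonGaussianSmearingZ3_algebraic_of_summable_sq` (every `α > 0`),
  `not_summable_sq_of_hasNonGaussianSmearingZ3_algebraic` (non-Gaussian ⟹ `B(β_c) = ∞`);
* the sharpened barrier `BubbleTrivialityOnZ3` (structured block below), `BubbleTrivialityOnZ3_holds`,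
  `BubbleTrivialityOnZ3.longRangeTrivialityOnZ3` (it implies the catalogued barrier — a third route to
  `LongRangeTrivialityOnZ3`, in which `α < 3/2` enters only through `B(β_c) < ∞`, generation 1's
  `summable_sq_pairCorrelation_criticalBeta`),
  `BubbleTrivialityOnZ3.of_member` / `hasNonGaussianSmearingZ3_member_imp` (every member of `Z3Model`,
  the nearest-neighbour one included, granted MMS2 for it in this formalisation), and
  `interactionUniformZ3_bubble_triviality`: "finite critical bubble ⟹ Gaussian" IS interaction-uniform on
  `Z3Model` (contrast `not_interactionUniformZ3_bubble_divergence` of generation 1).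

### C. Consequences for the parent block (text; proposed separately as docstring amendments)

`technique_class`: what `LongRangeTrivialityOnZ3` blocks is not "long-range-valid" reasoning as such but
BUBBLE-BLIND reasoning — every argument all of whose steps hold for one MMS-monotone ferromagnet on `ℤ³`
with `B(β_c) < ∞`. `evasions_known`: the nearest-neighbour model leaves that class by a theorem
(`B(β_c) = ∞`, growth `≥ c√(log n)`), so the barrier costs a nearest-neighbour proof exactly one thing — it
must consume the divergence of the bubble (or an input implying it) — and that is available; but the
divergence alone does not suffice (`ℤ⁴`: `B(β_c) = ∞` and Gaussian; `ℤ³`, `α = 3/2`: Gaussian either way),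
so the live gap is a `d = 3`-specific mechanism converting bubble GROWTH into `U₄ ≢ 0` (intersection of
currents below four dimensions), for which nothing is published (percolation analogue of low effective
dimension: conditional non-triviality of `k`-point functions [cite: Hutchcroft2025, Theorem II.1.11]).

## References

* R. Panis, arXiv:2309.05797 (2023) = Ann. Probab. 54 (2026): Remark 1.6 (p. 7), Corollary 1.11 (p. 8),
  §7.5 (p. 41), Theorem 12.2 and Remark 12.3 (p. 51), Corollary 3.3, proof of Theorem 5.5 (pp. 21–22)
  [Panis2023Triviality] (held; read pp. 6–8, 41, 51).
* H. Duminil-Copin, R. Panis, Commun. Math. Phys. 406 (2025), arXiv:2404.05700, Theorem 1.8, Remark 1.9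
  (pp. 6–7) [DuminilCopinPanis2025LowerBounds] (held; read pp. 6–7).
* M. Aizenman, H. Duminil-Copin, Ann. Math. 194 (2021), Theorem 1.2, §3 [AizenmanDuminilCopinAnnals2021]
  (held; read arXiv pp. 4–7, 17–18).
* M. Aizenman, arXiv:2112.04248 (CDM 2020), §11 [AizenmanCDM2020].
* T. Hutchcroft, arXiv:2508.18808 (2025), Theorems II.1.10–II.1.11 (p. 12), p. 17 [Hutchcroft2025] (held; read pp. 12, 17).

## Tree anchors

`treeFourE`, `treeFourBoxSum`, `treeFourBoxSum_nonneg`, `treeFourE_finite_and_sum_toReal_le`,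
`mgfDeviation_le_tree` (`…TreeWick`); `boxRowSum`, `boxRowSum_nonneg` (`…UrsellSum`);
`boxRowSum_le_near_mms`, `pairCorrelation_far_le_mms` (`…NoSlidingScale`); `pairCorrelation_zero_sub`,
`one_le_boxSusceptibility`, `boxSusceptibility_nonneg` (`…TwoPoint`); `pow_mul_boxSusceptibility_le_blockVariance`
(`…TwoPointProofs`); `state_smeared_sq_le`, `criticalBeta_nonneg`, `algebraicCoupling_nonneg/add` (`…Proofs`);
`exists_nat_forall_abs_apply_le` (`…Inputs`); `not_hasNonGaussianSmearingZ3_of_criticalBeta_eq_zero`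
(`…Reduction`); `panis_mms_two_point_monotone_holds` (`…MMSWalk`); `summable_sq_pairCorrelation_criticalBeta`,
`not_interactionUniformZ3_bubble_divergence` (`…ProofsAudit`); Mathlib: `sq_sum_le_card_mul_sum_sq`,
`Summable.comp_injective`, `Equiv.tsum_eq`, `Summable.tsum_finsetSum`, `Summable.tsum_le_tsum`,
`hasSum_sum_of_ne_finset_zero`, `tendsto_atTop_finset_of_monotone`, `Tendsto.const_div_atTop`.
-/

noncomputable section

namespace Literature.Barriers.CriticalPhenomena

open Literature.Probability.LatticeModels Literature.Probability.Percolation Filter Topology Finset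
open scoped ENNReal

namespace LongRangeIsing

section Bubble

variable (J : Site 3 → Site 3 → ℝ) (β : ℝ)

/-- The tail of the bubble diagram beyond `Λ_ℓ`, as a function on `ℤ³`:
`𝟙{x ∉ Λ_ℓ} ⟨σ₀σ_x⟩_β²` (so that `∑ₓ` of it is `B(β) - B_ℓ(β)`).
[cite: Panis2023Triviality, Theorem 1.5 (definition of B_L(β)) and Remark 1.6 (bubble condition)] -/
def bubbleTail (ℓ : ℕ) (x : Site 3) : ℝ := if x ∈ box 3 ℓ then 0 else pairCorrelation J β 0 x ^ 2

/-- The bubble tail is nonnegative. [folklore] -/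
theorem bubbleTail_nonneg (ℓ : ℕ) (x : Site 3) : 0 ≤ bubbleTail J β ℓ x := by
  unfold bubbleTail
  split_ifs
  · exact le_rfl
  · exact sq_nonneg _

/-- The bubble tail is dominated by `⟨σ₀σ_x⟩²`. [folklore] -/
theorem bubbleTail_le_sq (ℓ : ℕ) (x : Site 3) : bubbleTail J β ℓ x ≤ pairCorrelation J β 0 x ^ 2 := by
  unfold bubbleTail
  split_ifs
  · exact sq_nonneg _
  · exact le_rfl

/-! #### Step 1: a bound on the row sums `F_{RL}(u)` uniform in `u`, from MMS2 -/

/-- **`F_{RL}(u) ≤ 730·125R³·χ_L(β)` for every `u ∈ ℤ³`** (`R, L ≥ 1`; MMS2, translation invariance,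
`J ≥ 0`, `β ≥ 0`): near the box this is `boxRowSum_le_near_mms`; far from it each of the `|Λ_{RL}|`
terms is at most `χ_L/|Λ_L|` (`pairCorrelation_far_le_mms`) and `|Λ_{RL}| ≤ R³|Λ_L|`.
[cite: Panis2023Triviality, Corollary 3.3 (MMS2) and proof of Theorem 5.5, bound on (1), p. 22] -/
theorem boxRowSum_le_uniform_mms (hβ : 0 ≤ β) (hJ : ∀ x y, 0 ≤ J x y)
    (hJt : ∀ a x y, J (x + a) (y + a) = J x y)
    (hmms : ∀ x y : Site 3, (3 : ℝ) * ‖x‖ ≤ ‖y‖ → pairCorrelation J β 0 y ≤ pairCorrelation J β 0 x)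
    {R L : ℕ} (hR : 1 ≤ R) (hL : 1 ≤ L) (u : Site 3) :
    boxRowSum J β (R * L) u ≤ 730 * (125 * (R : ℝ) ^ 3) * boxSusceptibility J β L := by
  by_cases hu : u ∈ box 3 (4 * (R * L))
  · exact boxRowSum_le_near_mms J β hβ hJ hJt hmms hR hL hu
  · have hu' : 4 * (R * L) + 1 ≤ Site.supNorm u := by
      rw [mem_box_iff_supNorm_le] at hu
      omega
    have hχ0 : 0 ≤ boxSusceptibility J β L := boxSusceptibility_nonneg J β hβ hJ L
    have hcardL : (0 : ℝ) < #(box 3 L) := by exact_mod_cast (box_nonempty 3 L).card_pos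
    have hpt : ∀ y ∈ box 3 (R * L), pairCorrelation J β u y ≤ boxSusceptibility J β L / #(box 3 L) :=
      fun y hy => pairCorrelation_far_le_mms J β hβ hJ hJt hmms hR hu' hy
    have h1 : boxRowSum J β (R * L) u ≤ (#(box 3 (R * L)) : ℝ) * (boxSusceptibility J β L / #(box 3 L)) := by
      rw [boxRowSum, ← nsmul_eq_mul, ← Finset.sum_const]
      exact Finset.sum_le_sum hpt
    have hcards : (#(box 3 (R * L)) : ℝ) ≤ (R : ℝ) ^ 3 * #(box 3 L) := by
      rw [card_box, card_box]
      push_cast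
      have h2 : 2 * ((R : ℝ) * L) + 1 ≤ R * (2 * L + 1) := by
        have hR1 : (1 : ℝ) ≤ R := by exact_mod_cast hR
        nlinarith
      calc (2 * ((R : ℝ) * (L : ℝ)) + 1) ^ 3 ≤ ((R : ℝ) * (2 * L + 1)) ^ 3 :=
            pow_le_pow_left₀ (by positivity) h2 3
        _ = (R : ℝ) ^ 3 * (2 * (L : ℝ) + 1) ^ 3 := by ring
    have h730 : (R : ℝ) ^ 3 * boxSusceptibility J β L ≤ 730 * (125 * (R : ℝ) ^ 3) * boxSusceptibility J β L := by
      have : (R : ℝ) ^ 3 ≤ 730 * (125 * (R : ℝ) ^ 3) := by nlinarith [pow_nonneg (Nat.cast_nonneg R : (0:ℝ) ≤ R) 3]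
      exact mul_le_mul_of_nonneg_right this hχ0
    calc boxRowSum J β (R * L) u ≤ (#(box 3 (R * L)) : ℝ) * (boxSusceptibility J β L / #(box 3 L)) := h1
      _ ≤ (R : ℝ) ^ 3 * #(box 3 L) * (boxSusceptibility J β L / #(box 3 L)) :=
          mul_le_mul_of_nonneg_right hcards (div_nonneg hχ0 hcardL.le)
      _ = (R : ℝ) ^ 3 * boxSusceptibility J β L := by field_simp
      _ ≤ _ := h730

/-! #### Step 2: square-summability of the shifted two-point function and of the row sums -/

/-- `u ↦ ⟨σ_uσ_y⟩² = ⟨σ₀σ_{y-u}⟩²` is summable when the bubble diagram is finite. [folklore] -/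
theorem summable_sq_pairCorrelation_left (hβ : 0 ≤ β) (hJ : ∀ x y, 0 ≤ J x y)
    (hJt : ∀ a x y, J (x + a) (y + a) = J x y)
    (hB : Summable fun x : Site 3 => pairCorrelation J β 0 x ^ 2) (y : Site 3) :
    Summable fun u : Site 3 => pairCorrelation J β u y ^ 2 := by
  have h : (fun u : Site 3 => pairCorrelation J β u y ^ 2) =
      (fun x : Site 3 => pairCorrelation J β 0 x ^ 2) ∘ fun u => y - u := by
    funext u
    simp only [Function.comp_apply, pairCorrelation_zero_sub J β hβ hJ hJt u y]
  rw [h]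
  exact hB.comp_injective fun _ _ hab => sub_right_injective hab

/-- `∑ᵤ ⟨σ_uσ_y⟩² = B(β)` (translation invariance). [folklore] -/
theorem tsum_sq_pairCorrelation_left (hβ : 0 ≤ β) (hJ : ∀ x y, 0 ≤ J x y)
    (hJt : ∀ a x y, J (x + a) (y + a) = J x y) (y : Site 3) :
    ∑' u : Site 3, pairCorrelation J β u y ^ 2 = ∑' x : Site 3, pairCorrelation J β 0 x ^ 2 := by
  have h : ∀ u : Site 3, pairCorrelation J β u y ^ 2 = pairCorrelation J β 0 (Equiv.subLeft y u) ^ 2 := by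
    intro u
    rw [Equiv.subLeft_apply, pairCorrelation_zero_sub J β hβ hJ hJt u y]
  simp_rw [h]
  exact Equiv.tsum_eq (Equiv.subLeft y) (fun x => pairCorrelation J β 0 x ^ 2)

/-- The bubble tail is summable when the bubble diagram is finite. [folklore] -/
theorem summable_bubbleTail (hB : Summable fun x : Site 3 => pairCorrelation J β 0 x ^ 2) (ℓ : ℕ) :
    Summable (bubbleTail J β ℓ) :=
  hB.of_nonneg_of_le (bubbleTail_nonneg J β ℓ) (bubbleTail_le_sq J β ℓ)

/-- Shifted bubble tails are summable, with the same sum. [folklore] -/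
theorem summable_bubbleTail_shift (hB : Summable fun x : Site 3 => pairCorrelation J β 0 x ^ 2) (ℓ : ℕ)
    (y : Site 3) : Summable fun u : Site 3 => bubbleTail J β ℓ (y - u) :=
  (summable_bubbleTail J β hB ℓ).comp_injective fun _ _ hab => sub_right_injective hab

/-- `∑ᵤ 𝟙{y-u ∉ Λ_ℓ}⟨σ₀σ_{y-u}⟩² = ∑ₓ 𝟙{x ∉ Λ_ℓ}⟨σ₀σ_x⟩²` (reindexing `x = y - u`). [folklore] -/
theorem tsum_bubbleTail_shift (ℓ : ℕ) (y : Site 3) :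
    ∑' u : Site 3, bubbleTail J β ℓ (y - u) = ∑' x : Site 3, bubbleTail J β ℓ x :=
  Equiv.tsum_eq (Equiv.subLeft y) (bubbleTail J β ℓ)

/-! #### Step 3: the `ℓ`-split of `F_N(u)²` and its sum over `u` -/

/-- **Pointwise `ℓ`-split**: writing `F_N(u) = A + E` with `A` the terms `y - u ∈ Λ_ℓ` (at most `|Λ_ℓ|`
of them) and `E` the others, Cauchy–Schwarz gives
`F_N(u)² ≤ 2|Λ_ℓ| ∑_{y∈Λ_N} ⟨σ_uσ_y⟩² + 2|Λ_N| ∑_{y∈Λ_N} 𝟙{y-u ∉ Λ_ℓ}⟨σ₀σ_{y-u}⟩²`. [folklore] -/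
theorem sq_boxRowSum_le_split (hβ : 0 ≤ β) (hJ : ∀ x y, 0 ≤ J x y)
    (hJt : ∀ a x y, J (x + a) (y + a) = J x y) (ℓ N : ℕ) (u : Site 3) :
    boxRowSum J β N u ^ 2 ≤
      2 * (#(box 3 ℓ) : ℝ) * ∑ y ∈ box 3 N, pairCorrelation J β u y ^ 2 +
        2 * (#(box 3 N) : ℝ) * ∑ y ∈ box 3 N, bubbleTail J β ℓ (y - u) := by
  classical
  set s : Finset (Site 3) := box 3 N with hs
  set P : Site 3 → Prop := fun y => y - u ∈ box 3 ℓ with hP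
  set A : ℝ := ∑ y ∈ s.filter P, pairCorrelation J β u y with hA
  set E : ℝ := ∑ y ∈ s.filter (fun y => ¬ P y), pairCorrelation J β u y with hE
  have hsplit : boxRowSum J β N u = A + E := by
    rw [boxRowSum, hA, hE, ← hs]
    exact (Finset.sum_filter_add_sum_filter_not s P _).symm
  -- the near part
  have hcardA : (#(s.filter P) : ℝ) ≤ #(box 3 ℓ) := by
    have h : #(s.filter P) ≤ #(box 3 ℓ) := by
      refine Finset.card_le_card_of_injOn (fun y => y - u) (fun y hy => ?_) (fun y _ y' _ h => ?_)
      · exact Finset.mem_coe.2 (Finset.mem_filter.1 (Finset.mem_coe.1 hy)).2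
      · exact sub_left_injective h
    exact_mod_cast h
  have hA2 : A ^ 2 ≤ (#(box 3 ℓ) : ℝ) * ∑ y ∈ s, pairCorrelation J β u y ^ 2 := by
    calc A ^ 2 ≤ #(s.filter P) * ∑ y ∈ s.filter P, pairCorrelation J β u y ^ 2 := sq_sum_le_card_mul_sum_sq
      _ ≤ (#(box 3 ℓ) : ℝ) * ∑ y ∈ s, pairCorrelation J β u y ^ 2 := by
          refine mul_le_mul hcardA ?_ (Finset.sum_nonneg fun y _ => sq_nonneg _) (Nat.cast_nonneg _)
          exact Finset.sum_le_sum_of_subset_of_nonneg (Finset.filter_subset _ _) fun y _ _ => sq_nonneg _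
  -- the far part
  have hE2 : E ^ 2 ≤ (#(box 3 N) : ℝ) * ∑ y ∈ s, bubbleTail J β ℓ (y - u) := by
    have h1 : ∑ y ∈ s.filter (fun y => ¬ P y), pairCorrelation J β u y ^ 2 =
        ∑ y ∈ s.filter (fun y => ¬ P y), bubbleTail J β ℓ (y - u) := by
      refine Finset.sum_congr rfl fun y hy => ?_
      have hy' : y - u ∉ box 3 ℓ := (Finset.mem_filter.1 hy).2
      rw [bubbleTail, if_neg hy', pairCorrelation_zero_sub J β hβ hJ hJt u y]
    have hcardE : (#(s.filter fun y => ¬ P y) : ℝ) ≤ #(box 3 N) := by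
      rw [hs]
      exact_mod_cast Finset.card_le_card (Finset.filter_subset _ _)
    calc E ^ 2 ≤ #(s.filter fun y => ¬ P y) * ∑ y ∈ s.filter (fun y => ¬ P y), pairCorrelation J β u y ^ 2 :=
          sq_sum_le_card_mul_sum_sq
      _ = #(s.filter fun y => ¬ P y) * ∑ y ∈ s.filter (fun y => ¬ P y), bubbleTail J β ℓ (y - u) := by rw [h1]
      _ ≤ (#(box 3 N) : ℝ) * ∑ y ∈ s, bubbleTail J β ℓ (y - u) := by
          refine mul_le_mul hcardE ?_ (Finset.sum_nonneg fun y _ => bubbleTail_nonneg J β ℓ _) (Nat.cast_nonneg _)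
          exact Finset.sum_le_sum_of_subset_of_nonneg (Finset.filter_subset _ _)
            fun y _ _ => bubbleTail_nonneg J β ℓ _
  rw [hsplit]
  nlinarith [sq_nonneg (A - E), hA2, hE2]

/-- **The `ℓ`-split summed over `u`**: `∑ᵤ F_N(u)² ≤ 2|Λ_ℓ||Λ_N| B(β) + 2|Λ_N|² (B(β) - B_ℓ(β))`
(the tail written as `∑ₓ 𝟙{x∉Λ_ℓ}⟨σ₀σ_x⟩²`), for every auxiliary scale `ℓ`. This is the finite-bubble
mechanism of Panis's Theorem 12.2 (there with `εξ_σ(β)` in place of `ℓ` and `β ↗ β_c`), transplanted to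
`β` fixed and `L → ∞`. [cite: Panis2023Triviality, Theorem 12.2 (proof: the splitting (1)+(2)+(3) and B_{Lξ}-B_{εξ}), p. 51] -/
theorem tsum_sq_boxRowSum_le (hβ : 0 ≤ β) (hJ : ∀ x y, 0 ≤ J x y)
    (hJt : ∀ a x y, J (x + a) (y + a) = J x y)
    (hB : Summable fun x : Site 3 => pairCorrelation J β 0 x ^ 2) (ℓ N : ℕ) :
    (Summable fun u : Site 3 => boxRowSum J β N u ^ 2) ∧
      ∑' u : Site 3, boxRowSum J β N u ^ 2 ≤
        2 * (#(box 3 ℓ) : ℝ) * (#(box 3 N) : ℝ) * ∑' x : Site 3, pairCorrelation J β 0 x ^ 2 +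
          2 * (#(box 3 N) : ℝ) ^ 2 * ∑' x : Site 3, bubbleTail J β ℓ x := by
  set B : ℝ := ∑' x : Site 3, pairCorrelation J β 0 x ^ 2 with hBdef
  set T : ℝ := ∑' x : Site 3, bubbleTail J β ℓ x with hTdef
  set G₁ : Site 3 → ℝ := fun u => ∑ y ∈ box 3 N, pairCorrelation J β u y ^ 2 with hG₁
  set G₂ : Site 3 → ℝ := fun u => ∑ y ∈ box 3 N, bubbleTail J β ℓ (y - u) with hG₂
  have hG₁s : Summable G₁ := summable_sum fun y _ => summable_sq_pairCorrelation_left J β hβ hJ hJt hB y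
  have hG₂s : Summable G₂ := summable_sum fun y _ => summable_bubbleTail_shift J β hB ℓ y
  have hG₁t : ∑' u, G₁ u = (#(box 3 N) : ℝ) * B := by
    rw [hG₁, Summable.tsum_finsetSum (fun y _ => summable_sq_pairCorrelation_left J β hβ hJ hJt hB y)]
    rw [Finset.sum_congr rfl fun y _ => tsum_sq_pairCorrelation_left J β hβ hJ hJt y, Finset.sum_const,
      nsmul_eq_mul]
  have hG₂t : ∑' u, G₂ u = (#(box 3 N) : ℝ) * T := by
    rw [hG₂, Summable.tsum_finsetSum (fun y _ => summable_bubbleTail_shift J β hB ℓ y)]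
    rw [Finset.sum_congr rfl fun y _ => tsum_bubbleTail_shift J β ℓ y, Finset.sum_const, nsmul_eq_mul]
  set G : Site 3 → ℝ := fun u => 2 * (#(box 3 ℓ) : ℝ) * G₁ u + 2 * (#(box 3 N) : ℝ) * G₂ u with hG
  have hGs : Summable G := (hG₁s.mul_left _).add (hG₂s.mul_left _)
  have hGt : ∑' u, G u = 2 * (#(box 3 ℓ) : ℝ) * (#(box 3 N) : ℝ) * B + 2 * (#(box 3 N) : ℝ) ^ 2 * T := by
    rw [hG, (hG₁s.mul_left _).tsum_add (hG₂s.mul_left _), tsum_mul_left, tsum_mul_left, hG₁t, hG₂t]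
    ring
  have hle : ∀ u, boxRowSum J β N u ^ 2 ≤ G u := fun u => sq_boxRowSum_le_split J β hβ hJ hJt ℓ N u
  have hFs : Summable fun u : Site 3 => boxRowSum J β N u ^ 2 :=
    hGs.of_nonneg_of_le (fun u => sq_nonneg _) hle
  refine ⟨hFs, ?_⟩
  rw [← hGt]
  exact hFs.tsum_le_tsum hle hGs

/-! #### Step 4: the tree box sum under the bubble condition -/

/-- Bookkeeping of the real quantities in `treeFourBoxSum_le_of_summable_sq`: from `∑T ≤ (cχ)²F₂`,
`F₂ ≤ 2|Λ_ℓ||Λ_N|B + 2|Λ_N|²T`, `V ≥ L'³χ` and `|Λ_N| ≤ R'L'³` to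
`∑T/V² ≤ c²(2|Λ_ℓ|R'B/L'³ + 2R'²T)` — the factors `χ²` cancel. [folklore] -/
theorem bubble_bookkeeping {S V χ c F₂ cℓ cN B T L' R' : ℝ} (hχ : 0 < χ) (hL' : 0 < L')
    (hcℓ : 0 ≤ cℓ) (hcN : 0 ≤ cN) (hB : 0 ≤ B) (hT : 0 ≤ T) (hS0 : 0 ≤ S)
    (hS : S ≤ (c * χ) ^ 2 * F₂) (hF₂ : F₂ ≤ 2 * cℓ * cN * B + 2 * cN ^ 2 * T) (hV : L' ^ 3 * χ ≤ V)
    (hN : cN ≤ R' * L' ^ 3) :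
    S / V ^ 2 ≤ c ^ 2 * (2 * cℓ * R' * B / L' ^ 3 + 2 * R' ^ 2 * T) := by
  have hV0 : 0 < V := lt_of_lt_of_le (by positivity) hV
  have hLχ : 0 < L' ^ 3 * χ := by positivity
  have h1 : S / V ^ 2 ≤ S / (L' ^ 3 * χ) ^ 2 :=
    div_le_div_of_nonneg_left hS0 (by positivity) (pow_le_pow_left₀ hLχ.le hV 2)
  have h2 : S / (L' ^ 3 * χ) ^ 2 ≤ (c * χ) ^ 2 * F₂ / (L' ^ 3 * χ) ^ 2 :=
    div_le_div_of_nonneg_right hS (by positivity)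
  have h3 : (c * χ) ^ 2 * F₂ / (L' ^ 3 * χ) ^ 2 = c ^ 2 * (F₂ / L' ^ 6) := by
    field_simp
  have h4 : F₂ ≤ L' ^ 6 * (2 * cℓ * R' * B / L' ^ 3 + 2 * R' ^ 2 * T) := by
    have e : L' ^ 6 * (2 * cℓ * R' * B / L' ^ 3 + 2 * R' ^ 2 * T) =
        2 * cℓ * (R' * L' ^ 3) * B + 2 * (R' * L' ^ 3) ^ 2 * T := by
      field_simp
    rw [e]
    calc F₂ ≤ 2 * cℓ * cN * B + 2 * cN ^ 2 * T := hF₂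
      _ ≤ 2 * cℓ * (R' * L' ^ 3) * B + 2 * (R' * L' ^ 3) ^ 2 * T := by
          gcongr
  have h5 : F₂ / L' ^ 6 ≤ 2 * cℓ * R' * B / L' ^ 3 + 2 * R' ^ 2 * T := by
    rw [div_le_iff₀ (by positivity)]
    linarith [h4]
  calc S / V ^ 2 ≤ S / (L' ^ 3 * χ) ^ 2 := h1
    _ ≤ (c * χ) ^ 2 * F₂ / (L' ^ 3 * χ) ^ 2 := h2
    _ = c ^ 2 * (F₂ / L' ^ 6) := h3
    _ ≤ c ^ 2 * (2 * cℓ * R' * B / L' ^ 3 + 2 * R' ^ 2 * T) := mul_le_mul_of_nonneg_left h5 (sq_nonneg _)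

/-- **The tree box sum under a finite bubble diagram** (`d = 3`; `J ≥ 0` translation invariant, `β ≥ 0`,
MMS2 at `β`, `B(β) = ∑ₓ⟨σ₀σ_x⟩_β² < ∞`): for all `L, R ≥ 1` and every auxiliary scale `ℓ`, the tree
diagrams on `Λ_{RL}` are finite and
`𝒮_T(β,L,R) ≤ (730·125R³)² (2|Λ_ℓ|(2R+1)³ B(β)/(L+1)³ + 2(2R+1)⁶ ∑_{x∉Λ_ℓ}⟨σ₀σ_x⟩_β²)`.
Proof: `∑_{u∈Λ_{RL}⁴}T(u) = ∑_v F(v)⁴ ≤ M² ∑_v F(v)²` with `M = 730·125R³χ_L`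
(`boxRowSum_le_uniform_mms`), the `ℓ`-split `tsum_sq_boxRowSum_le`, and `Σ_L ≥ (L+1)³χ_L`
(`pow_mul_boxSusceptibility_le_blockVariance`) — the factors `χ_L²` cancel.
[cite: Panis2023Triviality, Theorem 12.2 (the bubble condition implies triviality), p. 51] -/
theorem treeFourBoxSum_le_of_summable_sq (hβ : 0 ≤ β) (hJ : ∀ x y, 0 ≤ J x y)
    (hJt : ∀ a x y, J (x + a) (y + a) = J x y)
    (hmms : ∀ x y : Site 3, (3 : ℝ) * ‖x‖ ≤ ‖y‖ → pairCorrelation J β 0 y ≤ pairCorrelation J β 0 x)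
    (hB : Summable fun x : Site 3 => pairCorrelation J β 0 x ^ 2) {L R : ℕ} (hL : 1 ≤ L) (hR : 1 ≤ R) (ℓ : ℕ) :
    (∀ u ∈ Fintype.piFinset (fun _ : Fin 4 => box 3 (R * L)), treeFourE J β u ≠ ⊤) ∧
      treeFourBoxSum J β L R ≤
        (730 * (125 * (R : ℝ) ^ 3)) ^ 2 *
          (2 * (#(box 3 ℓ) : ℝ) * (2 * (R : ℝ) + 1) ^ 3 * (∑' x : Site 3, pairCorrelation J β 0 x ^ 2) /
              ((L : ℝ) + 1) ^ 3 +
            2 * ((2 * (R : ℝ) + 1) ^ 3) ^ 2 * ∑' x : Site 3, bubbleTail J β ℓ x) := by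
  have hχ1 : 1 ≤ boxSusceptibility J β L := one_le_boxSusceptibility J β hβ hJ L
  have hχ0 : 0 < boxSusceptibility J β L := by linarith
  have hB0 : 0 ≤ ∑' x : Site 3, pairCorrelation J β 0 x ^ 2 := tsum_nonneg fun x => sq_nonneg _
  have hT0 : 0 ≤ ∑' x : Site 3, bubbleTail J β ℓ x := tsum_nonneg fun x => bubbleTail_nonneg J β ℓ x
  have hF0 : ∀ u, 0 ≤ boxRowSum J β (R * L) u := fun u => boxRowSum_nonneg J β hβ hJ _ u
  have hFM : ∀ u, boxRowSum J β (R * L) u ≤ 730 * (125 * (R : ℝ) ^ 3) * boxSusceptibility J β L :=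
    fun u => boxRowSum_le_uniform_mms J β hβ hJ hJt hmms hR hL u
  obtain ⟨hFs, hFt⟩ := tsum_sq_boxRowSum_le J β hβ hJ hJt hB ℓ (R * L)
  -- the majorant `g = M² F²`
  have hg0 : ∀ u : Site 3, 0 ≤ (730 * (125 * (R : ℝ) ^ 3) * boxSusceptibility J β L) ^ 2 *
      boxRowSum J β (R * L) u ^ 2 := fun u => mul_nonneg (sq_nonneg _) (sq_nonneg _)
  have hgs : Summable fun u : Site 3 => (730 * (125 * (R : ℝ) ^ 3) * boxSusceptibility J β L) ^ 2 *
      boxRowSum J β (R * L) u ^ 2 := hFs.mul_left _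
  have hFg : ∀ u : Site 3, boxRowSum J β (R * L) u ^ 4 ≤
      (730 * (125 * (R : ℝ) ^ 3) * boxSusceptibility J β L) ^ 2 * boxRowSum J β (R * L) u ^ 2 := by
    intro u
    have h2 : boxRowSum J β (R * L) u ^ 2 ≤ (730 * (125 * (R : ℝ) ^ 3) * boxSusceptibility J β L) ^ 2 :=
      pow_le_pow_left₀ (hF0 u) (hFM u) 2
    calc boxRowSum J β (R * L) u ^ 4 = boxRowSum J β (R * L) u ^ 2 * boxRowSum J β (R * L) u ^ 2 := by ring
      _ ≤ _ := mul_le_mul_of_nonneg_right h2 (sq_nonneg _)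
  obtain ⟨hfin, hU⟩ := treeFourE_finite_and_sum_toReal_le hβ hJ hg0 hgs hFg
  refine ⟨hfin, ?_⟩
  rw [tsum_mul_left] at hU
  have hS0 : 0 ≤ ∑ u ∈ Fintype.piFinset (fun _ : Fin 4 => box 3 (R * L)), (treeFourE J β u).toReal :=
    Finset.sum_nonneg fun _ _ => ENNReal.toReal_nonneg
  have hS : ∑ u ∈ Fintype.piFinset (fun _ : Fin 4 => box 3 (R * L)), (treeFourE J β u).toReal ≤
      (730 * (125 * (R : ℝ) ^ 3) * boxSusceptibility J β L) ^ 2 * ∑' u : Site 3, boxRowSum J β (R * L) u ^ 2 := hU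
  -- `Σ_L ≥ (L+1)³ χ_L` and `|Λ_{RL}| ≤ (2R+1)³ (L+1)³`
  have hVχ : ((L : ℝ) + 1) ^ 3 * boxSusceptibility J β L ≤ blockVariance J β L :=
    pow_mul_boxSusceptibility_le_blockVariance J β hβ hJ hJt L
  have hcardN : (#(box 3 (R * L)) : ℝ) ≤ (2 * (R : ℝ) + 1) ^ 3 * ((L : ℝ) + 1) ^ 3 := by
    rw [card_box]
    push_cast
    have hR0 : (0 : ℝ) ≤ R := Nat.cast_nonneg R
    have hL0 : (0 : ℝ) ≤ L := Nat.cast_nonneg L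
    have h1 : 2 * ((R : ℝ) * L) + 1 ≤ (2 * R + 1) * (L + 1) := by nlinarith
    calc (2 * ((R : ℝ) * (L : ℝ)) + 1) ^ 3 ≤ ((2 * (R : ℝ) + 1) * ((L : ℝ) + 1)) ^ 3 :=
        pow_le_pow_left₀ (by positivity) h1 3
      _ = _ := by ring
  rw [treeFourBoxSum]
  exact bubble_bookkeeping hχ0 (by positivity) (Nat.cast_nonneg _) (Nat.cast_nonneg _)
    hB0 hT0 hS0 (hS.trans (mul_le_mul_of_nonneg_left hFt (sq_nonneg _))) le_rfl hVχ hcardN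

/-! #### Step 5: the limits -/

/-- `B_ℓ(β) → B(β)`: the truncated bubble diagrams converge to the bubble diagram (boxes exhaust `ℤ³`). [folklore] -/
theorem tendsto_sum_box_sq_pairCorrelation (hB : Summable fun x : Site 3 => pairCorrelation J β 0 x ^ 2) :
    Tendsto (fun ℓ : ℕ => ∑ x ∈ box 3 ℓ, pairCorrelation J β 0 x ^ 2) atTop
      (𝓝 (∑' x : Site 3, pairCorrelation J β 0 x ^ 2)) := by
  have hbox : Tendsto (box 3) atTop atTop :=
    tendsto_atTop_finset_of_monotone (box_mono 3)
      fun x => ⟨Site.supNorm x, mem_box_iff_supNorm_le.2 le_rfl⟩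
  exact hB.hasSum.comp hbox

/-- The bubble tail `∑_{x∉Λ_ℓ}⟨σ₀σ_x⟩² = B(β) - B_ℓ(β)` tends to `0`. [folklore] -/
theorem tendsto_tsum_bubbleTail (hB : Summable fun x : Site 3 => pairCorrelation J β 0 x ^ 2) :
    Tendsto (fun ℓ : ℕ => ∑' x : Site 3, bubbleTail J β ℓ x) atTop (𝓝 0) := by
  set B : ℝ := ∑' x : Site 3, pairCorrelation J β 0 x ^ 2 with hBdef
  have hdecomp : ∀ ℓ : ℕ, ∑' x : Site 3, bubbleTail J β ℓ x = B - ∑ x ∈ box 3 ℓ, pairCorrelation J β 0 x ^ 2 := by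
    intro ℓ
    classical
    set h₁ : Site 3 → ℝ := fun x => if x ∈ box 3 ℓ then pairCorrelation J β 0 x ^ 2 else 0 with hh₁
    have hsum₁ : HasSum h₁ (∑ x ∈ box 3 ℓ, pairCorrelation J β 0 x ^ 2) := by
      have h : HasSum h₁ (∑ x ∈ box 3 ℓ, h₁ x) :=
        hasSum_sum_of_ne_finset_zero fun x hx => by rw [hh₁]; dsimp only; rw [if_neg hx]
      have he : ∑ x ∈ box 3 ℓ, h₁ x = ∑ x ∈ box 3 ℓ, pairCorrelation J β 0 x ^ 2 :=
        Finset.sum_congr rfl fun x hx => by rw [hh₁]; dsimp only; rw [if_pos hx]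
      rwa [he] at h
    have hpt : ∀ x, pairCorrelation J β 0 x ^ 2 = h₁ x + bubbleTail J β ℓ x := by
      intro x
      rw [hh₁, bubbleTail]
      by_cases hx : x ∈ box 3 ℓ
      · simp [hx]
      · simp [hx]
    have h2 : B = (∑ x ∈ box 3 ℓ, pairCorrelation J β 0 x ^ 2) + ∑' x, bubbleTail J β ℓ x := by
      rw [hBdef, tsum_congr hpt, hsum₁.summable.tsum_add (summable_bubbleTail J β hB ℓ), hsum₁.tsum_eq]
    linarith
  simp_rw [hdecomp]
  have h := (tendsto_sum_box_sq_pairCorrelation J β hB).const_sub B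
  rwa [sub_self] at h

/-- **The tree box sum tends to `0` under the bubble condition** (`d = 3`, `J ≥ 0` translation invariant,
`β ≥ 0`, MMS2 at `β`, `B(β) < ∞`), for every fixed `R ≥ 1`. [cite: Panis2023Triviality, Theorem 12.2, p. 51] -/
theorem tendsto_treeFourBoxSum_of_summable_sq (hβ : 0 ≤ β) (hJ : ∀ x y, 0 ≤ J x y)
    (hJt : ∀ a x y, J (x + a) (y + a) = J x y)
    (hmms : ∀ x y : Site 3, (3 : ℝ) * ‖x‖ ≤ ‖y‖ → pairCorrelation J β 0 y ≤ pairCorrelation J β 0 x)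
    (hB : Summable fun x : Site 3 => pairCorrelation J β 0 x ^ 2) {R : ℕ} (hR : 1 ≤ R) :
    Tendsto (fun L : ℕ => treeFourBoxSum J β L R) atTop (𝓝 0) := by
  set K : ℝ := (730 * (125 * (R : ℝ) ^ 3)) ^ 2 with hK
  set B : ℝ := ∑' x : Site 3, pairCorrelation J β 0 x ^ 2 with hBdef
  have hK0 : 0 ≤ K := sq_nonneg _
  have hB0 : 0 ≤ B := tsum_nonneg fun x => sq_nonneg _
  rw [Metric.tendsto_atTop]
  intro ε hε
  -- choose the auxiliary scale `ℓ`
  have hT := tendsto_tsum_bubbleTail J β hB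
  have hε2 : 0 < ε / 2 / (K * (2 * ((2 * (R : ℝ) + 1) ^ 3) ^ 2) + 1) := by positivity
  obtain ⟨ℓ, hℓ⟩ := (Metric.tendsto_atTop.1 hT) _ hε2
  have hTℓ := hℓ ℓ le_rfl
  rw [Real.dist_eq, sub_zero, abs_of_nonneg (tsum_nonneg fun x => bubbleTail_nonneg J β ℓ x)] at hTℓ
  set T : ℝ := ∑' x : Site 3, bubbleTail J β ℓ x with hTdef
  have hT0 : 0 ≤ T := tsum_nonneg fun x => bubbleTail_nonneg J β ℓ x
  -- choose `L₀` for the first term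
  set a : ℝ := K * (2 * (#(box 3 ℓ) : ℝ) * (2 * (R : ℝ) + 1) ^ 3 * B) with ha
  have ha0 : 0 ≤ a := by positivity
  have hlim : Tendsto (fun L : ℕ => a / ((L : ℝ) + 1) ^ 3) atTop (𝓝 0) := by
    have h1 : Tendsto (fun L : ℕ => ((L : ℝ) + 1) ^ 3) atTop atTop := by
      have h0 : Tendsto (fun L : ℕ => (L : ℝ) + 1) atTop atTop :=
        tendsto_natCast_atTop_atTop.atTop_add tendsto_const_nhds
      exact (tendsto_pow_atTop (n := 3) (by norm_num)).comp h0
    exact h1.const_div_atTop a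
  obtain ⟨L₀, hL₀⟩ := (Metric.tendsto_atTop.1 hlim) (ε / 2) (by positivity)
  refine ⟨max L₀ 1, fun L hL => ?_⟩
  have hL1 : 1 ≤ L := le_of_max_le_right hL
  have hLL₀ : L₀ ≤ L := le_of_max_le_left hL
  obtain ⟨_, hbound⟩ := treeFourBoxSum_le_of_summable_sq J β hβ hJ hJt hmms hB hL1 hR ℓ
  have hfirst := hL₀ L hLL₀
  rw [Real.dist_eq, sub_zero, abs_of_nonneg (by positivity)] at hfirst
  have hsecond : K * (2 * ((2 * (R : ℝ) + 1) ^ 3) ^ 2 * T) < ε / 2 := by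
    have h1 : K * (2 * ((2 * (R : ℝ) + 1) ^ 3) ^ 2) * T ≤ (K * (2 * ((2 * (R : ℝ) + 1) ^ 3) ^ 2) + 1) * T :=
      mul_le_mul_of_nonneg_right (by linarith) hT0
    have h2 : (K * (2 * ((2 * (R : ℝ) + 1) ^ 3) ^ 2) + 1) * T < ε / 2 := by
      have hpos : 0 < K * (2 * ((2 * (R : ℝ) + 1) ^ 3) ^ 2) + 1 := by positivity
      have := (lt_div_iff₀ hpos).1 hTℓ
      linarith [this]
    calc K * (2 * ((2 * (R : ℝ) + 1) ^ 3) ^ 2 * T) = K * (2 * ((2 * (R : ℝ) + 1) ^ 3) ^ 2) * T := by ring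
      _ < ε / 2 := lt_of_le_of_lt h1 h2
  rw [Real.dist_eq, sub_zero, abs_of_nonneg (treeFourBoxSum_nonneg J β L R)]
  calc treeFourBoxSum J β L R
      ≤ K * (2 * (#(box 3 ℓ) : ℝ) * (2 * (R : ℝ) + 1) ^ 3 * B / ((L : ℝ) + 1) ^ 3 +
          2 * ((2 * (R : ℝ) + 1) ^ 3) ^ 2 * T) := hbound
    _ = a / ((L : ℝ) + 1) ^ 3 + K * (2 * ((2 * (R : ℝ) + 1) ^ 3) ^ 2 * T) := by rw [ha]; ring
    _ < ε / 2 + ε / 2 := add_lt_add hfirst hsecond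
    _ = ε := by ring

/-- **The moment-generating-function deviation tends to `0` under the bubble condition** (`d = 3`,
`J ≥ 0` translation invariant, `β > 0`, MMS2 at `β`, `B(β) < ∞`; `f ∈ C_c(ℝ³)`, `z ∈ ℝ`):
`|⟨e^{zT_{f,L,β}}⟩_β - e^{(z²/2)⟨T²_{f,L,β}⟩_β}| → 0` — the tree-graph Wick bound `mgfDeviation_le_tree`,
the variance bound `state_smeared_sq_le` and `tendsto_treeFourBoxSum_of_summable_sq`.
[cite: Panis2023Triviality, Remark 1.6 and Theorem 12.2 (the bubble condition implies triviality)] -/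
theorem tendsto_mgfDeviation_of_summable_sq (hβ : 0 < β) (hJ : ∀ x y, 0 ≤ J x y)
    (hJt : ∀ a x y, J (x + a) (y + a) = J x y)
    (hmms : ∀ x y : Site 3, (3 : ℝ) * ‖x‖ ≤ ‖y‖ → pairCorrelation J β 0 y ≤ pairCorrelation J β 0 x)
    (hB : Summable fun x : Site 3 => pairCorrelation J β 0 x ^ 2)
    (f : EuclideanSpace ℝ (Fin 3) → ℝ) (hf : Continuous f) (hfs : HasCompactSupport f) (z : ℝ) :
    Tendsto (fun L : ℕ => mgfDeviation J β L f z) atTop (𝓝 0) := by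
  obtain ⟨R, hR, hfR⟩ := exists_nat_forall_abs_apply_le f hfs
  have hfa : Continuous fun x => |f x| := hf.abs
  have hfas : HasCompactSupport fun x => |f x| := hfs.norm
  obtain ⟨Cf, hCf⟩ := state_smeared_sq_le J β hβ.le hJ hJt (fun x => |f x|) hfa hfas
  set F : ℝ := (⨆ x, |f x|) ^ 4 with hF
  have hF0 : 0 ≤ F := pow_nonneg (Real.iSup_nonneg fun x => abs_nonneg (f x)) 4
  set Kc : ℝ := 32 * z ^ 4 * Real.exp (z ^ 2 / 2 * Cf) * F with hKc
  have hKc0 : 0 ≤ Kc := by positivity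
  have hS := tendsto_treeFourBoxSum_of_summable_sq J β hβ.le hJ hJt hmms hB hR
  have hmaj : ∀ L : ℕ, 1 ≤ L → mgfDeviation J β L f z ≤ Kc * treeFourBoxSum J β L R := by
    intro L hL
    obtain ⟨hfin, _⟩ := treeFourBoxSum_le_of_summable_sq J β hβ.le hJ hJt hmms hB hL hR 0
    have h1 := mgfDeviation_le_tree J β hJ hβ hL hR hf hfR hfin z
    have hS0 : 0 ≤ treeFourBoxSum J β L R := treeFourBoxSum_nonneg J β L R
    have h2 : Real.exp (z ^ 2 / 2 * state J β 0 (fun σ => smeared J β L (fun x => |f x|) σ ^ 2)) ≤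
        Real.exp (z ^ 2 / 2 * Cf) :=
      Real.exp_le_exp.2 (mul_le_mul_of_nonneg_left (hCf L hL) (by positivity))
    calc mgfDeviation J β L f z
        ≤ 32 * z ^ 4 * Real.exp (z ^ 2 / 2 * state J β 0 (fun σ => smeared J β L (fun x => |f x|) σ ^ 2)) *
            F * treeFourBoxSum J β L R := h1
      _ ≤ 32 * z ^ 4 * Real.exp (z ^ 2 / 2 * Cf) * F * treeFourBoxSum J β L R := by
          gcongr
      _ = Kc * treeFourBoxSum J β L R := by rw [hKc]
  have hlim : Tendsto (fun L : ℕ => Kc * treeFourBoxSum J β L R) atTop (𝓝 0) := by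
    simpa using hS.const_mul Kc
  refine squeeze_zero' (Eventually.of_forall fun L => abs_nonneg _) ?_ hlim
  exact eventually_atTop.2 ⟨1, hmaj⟩

end Bubble

end LongRangeIsing

open LongRangeIsing

/-! ### The headline: the bubble condition implies Gaussian critical smearing on `ℤ³` -/

/-- **The bubble condition implies triviality of the critical smeared scaling limits on `ℤ³`** — the
`β = β_c`, `L → ∞` form of "the bubble condition (together with some monotonicity properties of the
two-point function) implies triviality of the scaling limits" (Panis 2023, Remark 1.6, proved as
Theorem 12.2 through `g_σ(β) → 0`, `β ↗ β_c`; Aizenman 1982): for every ferromagnetic translation-invariant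
pair interaction `J ≥ 0` on `ℤ³` whose critical two-point function satisfies MMS2 (needed only if
`β_c > 0`) and `B(β_c) = ∑ₓ⟨σ₀σ_x⟩²_{β_c} < ∞`, every `f ∈ C_c(ℝ³)` and `z` have
`|⟨e^{zT_{f,L,β_c}}⟩ - e^{(z²/2)⟨T²_{f,L,β_c}⟩}| → 0`, i.e. `¬ HasNonGaussianSmearingZ3 J`. PROVED (the
tree-graph Wick bound by random currents, MMS2 comparisons, `Σ_L ≥ (L+1)³χ_L`, and the finite-bubble
splitting of Theorem 12.2 at `β_c`; `β_c = 0` by independence).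
[cite: Panis2023Triviality, Remark 1.6 (p. 7) and Theorem 12.2 (p. 51)] -/
theorem not_hasNonGaussianSmearingZ3_of_summable_sq {J : Site 3 → Site 3 → ℝ} (hJ : ∀ x y, 0 ≤ J x y)
    (hJt : ∀ a x y, J (x + a) (y + a) = J x y)
    (hmms : 0 < LongRangeIsing.criticalBeta J → ∀ x y : Site 3, (3 : ℝ) * ‖x‖ ≤ ‖y‖ →
      pairCorrelation J (LongRangeIsing.criticalBeta J) 0 y ≤ pairCorrelation J (LongRangeIsing.criticalBeta J) 0 x)
    (hB : Summable fun x : Site 3 => pairCorrelation J (LongRangeIsing.criticalBeta J) 0 x ^ 2) :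
    ¬ HasNonGaussianSmearingZ3 J := by
  rcases (criticalBeta_nonneg J).eq_or_lt with h0 | hpos
  · exact not_hasNonGaussianSmearingZ3_of_criticalBeta_eq_zero hJ h0.symm
  · rintro ⟨f, hf, hfs, z, hnot⟩
    exact hnot (tendsto_mgfDeviation_of_summable_sq J _ hpos hJ hJt (hmms hpos) hB f hf hfs z)

/-- **Every algebraically decaying reflection-positive model on `ℤ³` with a finite critical bubble
diagram has Gaussian critical smearings** — for EVERY `α > 0` (MMS2 for `J = C₀|x-y|₁^{-3-α}` at
`β_c > 0` is the theorem `panis_mms_two_point_monotone_holds`).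
[cite: Panis2023Triviality, Theorem 12.2 (p. 51) with Corollary 3.3 (MMS2)] -/
theorem not_hasNonGaussianSmearingZ3_algebraic_of_summable_sq {C₀ α : ℝ} (hC₀ : 0 < C₀) (hα : 0 < α)
    (hB : Summable fun x : Site 3 => pairCorrelation (algebraicCoupling 3 C₀ α)
      (LongRangeIsing.criticalBeta (algebraicCoupling 3 C₀ α)) 0 x ^ 2) :
    ¬ HasNonGaussianSmearingZ3 (algebraicCoupling 3 C₀ α) :=
  not_hasNonGaussianSmearingZ3_of_summable_sq (algebraicCoupling_nonneg hC₀.le α) (algebraicCoupling_add C₀ α)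
    (fun hpos x y h => panis_mms_two_point_monotone_holds 3 (by norm_num) C₀ α hC₀ hα _ hpos x y
      (by exact_mod_cast h)) hB

/-- **Non-Gaussian critical smearing forces a divergent critical bubble diagram** within Panis's family
(contrapositive; every `α > 0`): the only way a member `C₀|x-y|₁^{-3-α}` can be non-trivial is
`B(β_c) = ∞`. [cite: Panis2023Triviality, Remark 1.6 and Theorem 12.2] -/
theorem not_summable_sq_of_hasNonGaussianSmearingZ3_algebraic {C₀ α : ℝ} (hC₀ : 0 < C₀) (hα : 0 < α)
    (hng : HasNonGaussianSmearingZ3 (algebraicCoupling 3 C₀ α)) :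
    ¬ Summable fun x : Site 3 => pairCorrelation (algebraicCoupling 3 C₀ α)
      (LongRangeIsing.criticalBeta (algebraicCoupling 3 C₀ α)) 0 x ^ 2 :=
  fun hB => not_hasNonGaussianSmearingZ3_algebraic_of_summable_sq hC₀ hα hB hng

/-! ### The sharpened barrier -/

/-- **Barrier `BubbleTrivialityOnZ3` (sharpened, intrinsic form of `LongRangeTrivialityOnZ3`; audit
2026-08-15, generation 2).** On `ℤ³`, every ferromagnetic translation-invariant pair interaction `J ≥ 0`
whose critical two-point function is Messager–Miracle-Solé monotone (MMS2; needed only when `β_c > 0`)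
and square-summable — the bubble condition `B(β_c) = ∑ₓ⟨σ₀σ_x⟩²_{β_c} < ∞` — has Gaussian critical
smeared scaling limits: `¬ HasNonGaussianSmearingZ3 J`. PROVED (`BubbleTrivialityOnZ3_holds`): the
`β = β_c`, `L → ∞` form of "the bubble condition (together with some monotonicity properties of the
two-point function) implies triviality of the scaling limits" — printed as `g_σ(β) → 0`, `β ↗ β_c`.

BARRIER (structured block, D-0021):
- technique_class: bubble-blind arguments on `ℤ³` — arguments for non-triviality of the critical nearest-neighbour model (clause (iii), smeared form `HasNonGaussianSmearingZ3`) every step of which holds for SOME ferromagnetic translation-invariant pair interaction on `ℤ³` with MMS-monotone critical two-point function and finite critical bubble diagram — formally the hypotheses of `BubbleTrivialityOnZ3` (`J ≥ 0`, translation invariance, MMS2 at `β_c`, `Summable (⟨σ₀σ_x⟩²_{β_c})`); it CONTAINS the interaction-uniform class `InteractionUniformZ3` of `LongRangeTrivialityOnZ3`, whose `α < 3/2` members have `B(β_c) < ∞` (`LongRangeIsing.summable_sq_pairCorrelation_criticalBeta`) [cite: Panis2023Triviality, Remark 1.6 (p. 7) and Theorem 12.2 (p. 51)]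
- blocks: `HasNonGaussianSmearingZ3 J` for every such `J`; within Panis's family `C₀|x-y|₁^{-3-α}` — EVERY `α > 0`, MMS2 being the theorem `panis_mms_two_point_monotone_holds` — a non-Gaussian critical smearing forces `B(β_c) = ∞` (`not_summable_sq_of_hasNonGaussianSmearingZ3_algebraic`); the parametric barrier `LongRangeTrivialityOnZ3` (`α < 3/2`) is the corollary `BubbleTrivialityOnZ3.longRangeTrivialityOnZ3` [cite: Panis2023Triviality, Theorem 1.2 and Theorem 12.2]
- because: the tree-graph Wick bound (random currents) controls the deviation of `T_{f,L,β}` from Gaussianity by `𝒮_T = Σ_L⁻²∑_{u∈Λ_{RL}⁴}T(u) = Σ_L⁻²∑_vF_{RL}(v)⁴` [cite: Panis2023Triviality, proof of Theorem 5.5 (pp. 21–22) with Proposition 4.6]; MMS2 gives `F_{RL} ≤ CR³χ_L` uniformly [cite: Panis2023Triviality, Corollary 3.3 (MMS2)] and `Σ_L ≥ (L+1)³χ_L`, so `𝒮_T ≤ C_R∑_vF(v)²/(L+1)⁶`, and a finite bubble splits `∑_vF(v)² ≤ 2|Λ_ℓ||Λ_{RL}|B + 2|Λ_{RL}|²(B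 - B_ℓ) = o(L⁶)` — the mechanism of "the bubble condition implies triviality" [cite: Panis2023Triviality, Theorem 12.2 (proof), p. 51], run at `β = β_c` with `L → ∞` in place of `β ↗ β_c`, `ξ_σ(β) → ∞`
- evasions_known: the nearest-neighbour model on `ℤ³` LEAVES the class, by a theorem: "Theorem 1.8 (Divergence of the bubble diagram). Let `d = 3, 4`. Then `B(β_c) = ∞`", quantitatively `B_n(β_c) ≥ c√(log n)` for `d = 3` [cite: DuminilCopinPanis2025LowerBounds, Theorem 1.8 and Remark 1.9]; leaving the class is NOT sufficient: the nearest-neighbour model on `ℤ⁴` has `B(β_c) = ∞` [cite: DuminilCopinPanis2025LowerBounds, Theorem 1.8] and Gaussian critical scaling limits ("included in Theorem 1.2 is the statement that for `d = 4` any scaling limit of the critical Ising model is Gaussian") [cite: AizenmanDuminilCopinAnnals2021, Theorem 1.2], and on `ℤ³` the marginal member `α = 3/2` is Gaussian whether or not its bubble diverges ("if `B(β_c) = ∞`, one obtains the result taking `L` to infinity. If `B(β_c) < ∞`, we may conclude using Theorem 12.2") [cite: Panis2023Triviality, Corollary 1.11 (p. 8) and §7.5 (p. 41)]; no argument converting `B(β_c)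 = ∞` plus a `d = 3`-specific input into `U₄ ≢ 0` is published (open question 1 of §11) [cite: AizenmanCDM2020, §11]; for long-range PERCOLATION of low effective dimension the analogous non-triviality of the critical `k`-point functions is proved, conditionally on a correlation-length hypothesis [cite: Hutchcroft2025, Theorem II.1.11]; AUDIT 2026-08-15, generation 3: the class cannot be left through the pointwise clause or a clever renormalisation — a pointwise scaling limit with `U₄ ≢ 0` of any MMS-monotone member of `Z3Model` forces `B(β_c) = ∞` (`hasNontrivialU4_member_imp`, `LongRangeTrivialityOnZ3PointwiseAudit.lean`) [cite: Panis2023Triviality, Theorem 12.2 (p. 51)]; AUDIT 2026-08-15, generation 4 (`LongRangeTrivialityOnZ3SusceptibilityAudit.lean`): leaving THIS class is not even the right currency — the tree-diagram mechanism reaches the larger class `χ_L(β_c) = o(L^{3/2})` (`SusceptibilityTrivialityOnZ3`, PROVED, which implies this barrier through `LongRangeIsing.tendsto_boxSusceptibility_sq_div_of_summable_sq`), inside which `B(β_c) = ∞` with `B_n ≥ c√(log n)` still sits (`⟨σ₀σ_x⟩ ≍ |x|^{-3/2}(log|x|)^{-1/4}`); the nearest-neighbour model on `ℤ³` leaves the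 larger class too, by the reflected-current lower bound of Theorem 1.3 at `β_c` with the MMS inequalities (`limsup_n χ_n(β_c)/n^{3/2} > 0`, paper derivation in that file), which is exactly the necessary condition `hasNonGaussianSmearingZ3_member_imp_frequently` [cite: DuminilCopinPanis2025LowerBounds, Theorems 1.3 and 1.5]
- scope_caveats: (a) smeared averages `T_{f,L,β_c}` with the `Σ_L(β_c)` normalisation and the free-boundary box-limit state, exactly as in `LongRangeTrivialityOnZ3` (a); AUDIT 2026-08-15, generation 3 (`LongRangeTrivialityOnZ3PointwiseAudit.lean`): under the SAME hypotheses (`J ≥ 0` translation invariant, MMS2 at `β_c` when `β_c > 0`, `B(β_c) < ∞`) the POINTWISE clause (iii) is blocked as well — every pointwise scaling limit `S` of `ρ(δ)ⁿ⟨∏σ_{[xᵢ/δ]}⟩_{β_c}`, any renormalisation `ρ`, no non-degeneracy of `S₂` assumed, has `U₄^S ≡ 0` on non-coincident configurations (`LongRangeIsing.limitConnectedFour_eq_zero_criticalBeta_of_summable_sq`; tree diagram bound, bubble tail by Cauchy–Schwarz, MMS2 beyond the bulk) [cite: Panis2023Triviality, Remark 1.6 (p. 7) and Theorem 12.2 (p.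 51)]; what remains of (a): free-boundary versus plus state for the nearest-neighbour member, and only `U₄` of a pointwise limit (not the higher cumulants) is addressed; (b) MMS2 at `β_c` is a hypothesis for general `J` — proved for `C₀|x-y|₁^{-d-α}` (`panis_mms_two_point_monotone_holds`); for the nearest-neighbour coupling the tree's `messager_miracleSole(_diag)_holds` concern the `NNIsing` formalisation and are not bridged to `LongRangeIsing.state (nnCoupling 3)`, so `BubbleTrivialityOnZ3.of_member` carries it as a hypothesis there; (c) the printed Theorem 12.2 is the near-critical statement `g_σ(β) → 0` (`β ↗ β_c`) for reflection-positive models in the Griffiths–Simon class; proved here is its `β = β_c`, `L → ∞` analogue for Ising spins by the same splitting — an analogue, not a vendoring; (d) `β_c` is the tree's `sInf {β > 0 | m*(β) > 0}` (`0` if there is no transition; then the state is a product measure and the conclusion holds by independence); (e) nothing is said about interactions violating MMS2 or translation invariance, nor about the size of the gap between `√(log n)` bubble growth and non-Gaussianity; AUDIT 2026-08-15, generation 4 (`LongRangeTrivialityOnZ3SusceptibilityAudit.lean`): the second half of (e) is now quantified — the mechanism of this barrier reaches exactly `χ_L(β_c)²/L³ → 0` (sufficient: `SusceptibilityTrivialityOnZ3_holds`;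 necessary: `LongRangeIsing.boxSusceptibility_sq_div_le_treeFourBoxSum`), `√(log n)` bubble growth does not exclude it, and the nearest-neighbour model is outside by Duminil-Copin–Panis's Theorem 1.3; what remains between `limsup χ_L(β_c)/L^{3/2} > 0` and `U₄ ≢ 0` is a lower bound on `|U₄|` of the order of the tree diagram [cite: DuminilCopinPanis2025LowerBounds, Theorem 1.3] [cite: AizenmanCDM2020, Lemma 8.1 eq. (8.1) (p. 25) and §11 (p. 35)]
- status: established (PROVED: `BubbleTrivialityOnZ3_holds`; axioms `propext`, `Classical.choice`, `Quot.sound`)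

[cite: Panis2023Triviality, Remark 1.6 (p. 7) and Theorem 12.2 (p. 51)] -/
def BubbleTrivialityOnZ3 : Prop :=
  ∀ J : Site 3 → Site 3 → ℝ, (∀ x y, 0 ≤ J x y) → (∀ a x y, J (x + a) (y + a) = J x y) →
    (0 < LongRangeIsing.criticalBeta J → ∀ x y : Site 3, (3 : ℝ) * ‖x‖ ≤ ‖y‖ →
      pairCorrelation J (LongRangeIsing.criticalBeta J) 0 y ≤ pairCorrelation J (LongRangeIsing.criticalBeta J) 0 x) →
    (Summable fun x : Site 3 => pairCorrelation J (LongRangeIsing.criticalBeta J) 0 x ^ 2) →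
      ¬ HasNonGaussianSmearingZ3 J

/-- **The sharpened barrier holds.** [cite: Panis2023Triviality, Remark 1.6 (p. 7) and Theorem 12.2 (p. 51)] -/
theorem BubbleTrivialityOnZ3_holds : BubbleTrivialityOnZ3 :=
  fun _ hJ hJt hmms hB => not_hasNonGaussianSmearingZ3_of_summable_sq hJ hJt hmms hB

/-- **The sharpened barrier implies the catalogued one** (`α < 3/2 ⟹ B(β_c) < ∞ ⟹` Gaussian).
[cite: Panis2023Triviality, Theorem 1.2 and Theorem 12.2] -/
theorem BubbleTrivialityOnZ3.longRangeTrivialityOnZ3 (h : BubbleTrivialityOnZ3) : LongRangeTrivialityOnZ3 := by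
  intro C₀ α hC₀ hα hα'
  exact h _ (algebraicCoupling_nonneg hC₀.le α) (algebraicCoupling_add C₀ α)
    (fun hpos x y hxy => panis_mms_two_point_monotone_holds 3 (by norm_num) C₀ α hC₀ hα _ hpos x y
      (by exact_mod_cast hxy))
    (summable_sq_pairCorrelation_criticalBeta hC₀ hα hα')

/-- Every member of `Z3Model` has nonnegative couplings. [cite: Panis2023Triviality, §1.2.1 ((A1) ferromagnetic)] -/
theorem Z3Model.coupling_nonneg (m : Z3Model) (x y : Site 3) : 0 ≤ m.coupling x y := by
  cases m with
  | nearestNeighbour =>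
    change 0 ≤ nnCoupling 3 x y
    unfold nnCoupling
    split_ifs <;> norm_num
  | algebraic C₀ α hC₀ hα => exact algebraicCoupling_nonneg hC₀.le α x y

/-- Every member of `Z3Model` is translation invariant. [cite: Panis2023Triviality, §1.2.1 ((A3) translation invariant)] -/
theorem Z3Model.coupling_add (m : Z3Model) (a x y : Site 3) : m.coupling (x + a) (y + a) = m.coupling x y := by
  cases m with
  | nearestNeighbour =>
    change nnCoupling 3 (x + a) (y + a) = nnCoupling 3 x y
    unfold nnCoupling
    rw [add_sub_add_right_eq_sub]
  | algebraic C₀ α hC₀ hα => exact algebraicCoupling_add C₀ α a x y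

/-- **The sharpened barrier on the family `Z3Model`** (nearest-neighbour member included): a member whose
critical two-point function is MMS-monotone (a hypothesis only for the nearest-neighbour member in this
formalisation) and square-summable has Gaussian critical smearings.
[cite: Panis2023Triviality, Remark 1.6 and Theorem 12.2] -/
theorem BubbleTrivialityOnZ3.of_member (h : BubbleTrivialityOnZ3) (m : Z3Model)
    (hmms : 0 < LongRangeIsing.criticalBeta m.coupling → ∀ x y : Site 3, (3 : ℝ) * ‖x‖ ≤ ‖y‖ →
      pairCorrelation m.coupling (LongRangeIsing.criticalBeta m.coupling) 0 y ≤
        pairCorrelation m.coupling (LongRangeIsing.criticalBeta m.coupling) 0 x)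
    (hB : Summable fun x : Site 3 => pairCorrelation m.coupling (LongRangeIsing.criticalBeta m.coupling) 0 x ^ 2) :
    ¬ HasNonGaussianSmearingZ3 m.coupling :=
  h m.coupling m.coupling_nonneg m.coupling_add hmms hB

/-- **Non-triviality on `ℤ³` costs a divergent bubble**: for any member of `Z3Model` with MMS-monotone
critical two-point function — in particular for the nearest-neighbour model, granted MMS2 for it — a
non-Gaussian critical smearing implies `B(β_c) = ∑ₓ⟨σ₀σ_x⟩²_{β_c} = ∞` (which, for the nearest-neighbour
model on `ℤ³`, is Duminil-Copin–Panis's Theorem 1.8). [cite: DuminilCopinPanis2025LowerBounds, Theorem 1.8] [cite: Panis2023Triviality, Theorem 12.2] -/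
theorem hasNonGaussianSmearingZ3_member_imp (m : Z3Model)
    (hmms : 0 < LongRangeIsing.criticalBeta m.coupling → ∀ x y : Site 3, (3 : ℝ) * ‖x‖ ≤ ‖y‖ →
      pairCorrelation m.coupling (LongRangeIsing.criticalBeta m.coupling) 0 y ≤
        pairCorrelation m.coupling (LongRangeIsing.criticalBeta m.coupling) 0 x)
    (hng : HasNonGaussianSmearingZ3 m.coupling) :
    ¬ Summable fun x : Site 3 => pairCorrelation m.coupling (LongRangeIsing.criticalBeta m.coupling) 0 x ^ 2 :=
  fun hB => BubbleTrivialityOnZ3_holds.of_member m hmms hB hng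

/-- **"Finite critical bubble ⟹ Gaussian critical smearing" IS an interaction-uniform property on `ℤ³`**
(it holds for every member of `Z3Model`, MMS2 granted), in contrast with "the critical bubble diverges",
which is not (`not_interactionUniformZ3_bubble_divergence`): the barrier separates models by `B(β_c)`, not by
the range of the interaction. [cite: Panis2023Triviality, Remark 1.6 and Theorem 12.2] -/
theorem interactionUniformZ3_bubble_triviality :
    InteractionUniformZ3 fun m =>
      (0 < LongRangeIsing.criticalBeta m.coupling → ∀ x y : Site 3, (3 : ℝ) * ‖x‖ ≤ ‖y‖ →
        pairCorrelation m.coupling (LongRangeIsing.criticalBeta m.coupling) 0 y ≤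
          pairCorrelation m.coupling (LongRangeIsing.criticalBeta m.coupling) 0 x) →
      (Summable fun x : Site 3 => pairCorrelation m.coupling (LongRangeIsing.criticalBeta m.coupling) 0 x ^ 2) →
        ¬ HasNonGaussianSmearingZ3 m.coupling :=
  fun m hmms hB => BubbleTrivialityOnZ3_holds.of_member m hmms hB

end Literature.Barriers.CriticalPhenomena

end
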